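import Mathlib
import Literature.NumberTheory.LFunctions.Zhang2022.SkeletonPartThree
import Literature.NumberTheory.LFunctions.Zhang2022.TypedAppendixB
import Literature.NumberTheory.LFunctions.Zhang2022.AppendixBLemma151Circles
import Literature.Analysis.Complex.RectangleResidueDoublePoles

/-!
# Zhang (2022) Appendix B, proof of Lemma 15.1, `μ = 2`: the small rectangle around the poles of
# `ζ(1+s)/ζ(1+s−β_j)·(P₂/l₁)ˢ/((log P₂)(s−β₇)²)` carries the same integral as the circle `|s| = 5α`

Topic `Literature/NumberTheory/LFunctions/Zhang2022` (Landau–Siegel audit tree; verdict-neutral).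
Y. Zhang, *Discrete mean estimates and the Landau–Siegel zero*, arXiv:2211.02515v1 (2022)
[Zhang2022LandauSiegel] — **an unrefereed manuscript under adjudication; nothing in this file
asserts any claim of the manuscript.** ZHANG-L discharge lane (WP15, App. B block B1 under the
leaf `Typed.Section15C.Eq15_22`, Lemma 15.1 χ-reading), DAG node `Z22:§B.u009` (text after the
display) [Z22 p.107, tex L5298]: "In a way similar to the proof of Lemma 8.1, we see that the right
side is equal to the sum of the residues of the integrand at `s = 0` and `s = β₇` plus an acceptable
error" — typed (reading of record) as `Typed.AppendixB.StepB_u009rR`: the vertical line `Re s = 1` of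
`intB2 c′ D j l₁` minus `(2πi)⁻¹∮_{|s|=5α} intB2` is `O(α₁)`.

This file PROVES the residue step of that contour argument for the ACTUAL integrand `intB2`
(`= zetaRatio·kerB`, `TypedAppendixB`): there is an absolute `δ₀ > 0` (a quarter of the radius of
`AppendixBLemma151Cauchy.zeta1_near_one`) such that for `D` large, `j ∈ {1,2,3}`, `l₁ ≥ 1` and every
`0 < ε ≤ δ₀`,

  `∮_{∂([−δ₀, ε] × [−δ₀, δ₀])} intB2 = ∮_{|s| = 5α} intB2`

(`intB2_rect_eq_circle`; the four-term `rectBoundaryIntegral` of `Literature.Analysis.Complex`).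
Inside the box the integrand is `G(s)/(s(s−β₇)²)` with
`G(s) = ζ₁(1+s)(s−β_j)ζ₁(1+s−β_j)⁻¹(P₂/l₁)ˢ/log P₂` holomorphic (`AppendixBLemma151Circles.intB2_eq_G_div`,
`differentiableOn_G`) — a simple pole at `0`, a double pole at `β₇ = 5iα/2`, and the removable point
`s = β_j` where the typed `intB2` carries Mathlib's junk value of `ζ(1)` (invisible to the integrals;
handled as a "pole" with zero residue). The rectangle residue theorem with poles of order `≤ 2`
(`Literature.Analysis.Complex.rectBoundaryIntegral_eq_sum_of_doublePoles`) gives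
`2πi·(G(0)/β₇² − G(β₇)/β₇² + G′(β₇)/β₇)`, which is the closed form of `∮_{|s|=5α} intB2`
(`AppendixBLemma151Circles.circleIntegrals_intB2`).

WHAT THIS IS NOT: the line-to-rectangle shift and the estimates of `StepB_u009rR` (next file), Lemma
15.1, or any claim about Theorems 1–2 / Landau–Siegel zeros.

## References

* Y. Zhang, arXiv:2211.02515v1 (2022), App. B p. 107. [cite: Zhang2022LandauSiegel, App. B p.107]
* J. B. Conway, *Functions of One Complex Variable I*, GTM 11, Ch. V §2 (residue theorem). [Conway1978]
-/

noncomputable section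

open Complex Real Metric Set Filter Topology

namespace Literature.NumberTheory.LFunctions.Zhang2022.Skeleton

open Typed.AppendixB (zetaRatio kerB intB2)
open Literature.Analysis.Complex (rectBoundaryIntegral rectBoundaryIntegral_eq_sum_of_doublePoles
  doublePole_data_of_simplePole)

section Rect

variable (c' : ℝ)

/-- `L₀ ≤ log D` once `D ≥ ⌈exp L₀⌉₊`. [folklore] -/
private theorem le_ell_of_ceil_exp_le₄ {L₀ : ℝ} {D : ℕ} (hD : ⌈Real.exp L₀⌉₊ ≤ D) : L₀ ≤ ell D := by
  have h : Real.exp L₀ ≤ D := le_trans (Nat.le_ceil _) (by exact_mod_cast hD)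
  exact (Real.le_log_iff_exp_le (lt_of_lt_of_le (Real.exp_pos _) h)).mpr h

/-- A point of norm `< r` with real part `< ε` lies in the open box `(−r, ε) × (−r, r)`. [folklore] -/
private theorem mem_box_of_norm_lt {z : ℂ} {r ε : ℝ} (hz : ‖z‖ < r) (hε : z.re < ε) :
    z ∈ Ioo (-r) ε ×ℂ Ioo (-r) r := by
  have hre := Complex.abs_re_le_norm z
  have him := Complex.abs_im_le_norm z
  rw [mem_reProdIm]
  exact ⟨⟨by linarith [neg_abs_le z.re], hε⟩,
    ⟨by linarith [neg_abs_le z.im], by linarith [le_abs_self z.im]⟩⟩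

/-- The closed box `[−r, ε] × [−r, r]` (`0 < r`, `ε ≤ r`) lies in the open disc of radius `3r`.
[folklore] -/
private theorem box_subset_ball {r ε : ℝ} (hr : 0 < r) (hε : ε ≤ r) :
    Icc (-r) ε ×ℂ Icc (-r) r ⊆ ball (0 : ℂ) (3 * r) := by
  intro z hz
  rw [mem_reProdIm] at hz
  obtain ⟨⟨h1, h2⟩, ⟨h3, h4⟩⟩ := hz
  rw [mem_ball_zero_iff]
  have hre : |z.re| ≤ r := abs_le.mpr ⟨h1, le_trans h2 hε⟩
  have him : |z.im| ≤ r := abs_le.mpr ⟨h3, h4⟩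
  calc ‖z‖ ≤ |z.re| + |z.im| := Complex.norm_le_abs_re_add_abs_im z
    _ ≤ r + r := add_le_add hre him
    _ < 3 * r := by linarith

/-- **The rectangle around the poles carries the circle integral.** There is an absolute `δ₀ > 0`
such that for `D` large, `j ∈ {1,2,3}`, `l₁ ≥ 1` and `0 < ε ≤ δ₀`:
`∮_{∂([−δ₀, ε] × [−δ₀, δ₀])} intB2 = ∮_{|s|=5α} intB2` (both equal `2πi` times
`G(0)/β₇² − G(β₇)/β₇² + G′(β₇)/β₇`). The right vertical side `Re s = ε` may be arbitrarily close to
the poles (the application takes `ε = 1/log(P₂/l₁)`). [cite: Zhang2022LandauSiegel, App. B p.107] -/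
theorem intB2_rect_eq_circle : ∃ δ₀ : ℝ, 0 < δ₀ ∧ ∃ D₀ : ℕ, ∀ D : ℕ, D₀ ≤ D →
    ∀ j ∈ ({1, 2, 3} : Finset ℕ), ∀ l₁ : ℕ, 1 ≤ l₁ → ∀ ε : ℝ, 0 < ε → ε ≤ δ₀ →
      rectBoundaryIntegral (intB2 c' D j l₁) (-δ₀) ε (-δ₀) δ₀ =
        ∮ s in C((0 : ℂ), 5 * alpha D), intB2 c' D j l₁ s := by
  obtain ⟨δ, hδ, K, hK, hζ⟩ := zeta1_near_one
  obtain ⟨D₁, hcirc⟩ := circleIntegrals_intB2 c'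
  have hδ2 : 0 < δ / 2 := by positivity
  refine ⟨δ / 4, by positivity,
    max D₁ (max 8 ⌈Real.exp (max (max 2 (60 * |c'| * π)) (max (10 * π / (δ / 2)) (8 * K * π)))⌉₊),
    fun D hD j hj l₁ hl₁ ε hε hεδ => ?_⟩
  obtain ⟨h5, -, -⟩ := hcirc D (le_trans (le_max_left _ _) hD) j hj l₁ hl₁
  obtain ⟨hℓ2, hc, hδα, -, hα0, -, hLlow⟩ := large_package c' hδ2 hK
    (le_ell_of_ceil_exp_le₄ (le_trans (le_max_right _ _) (le_trans (le_max_right _ _) hD)))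
  obtain ⟨-, hb4, hb2, hb7, hn7⟩ := betaJ_size c' hℓ2 hc hj
  -- notation (as in `AppendixBLemma151Circles`)
  set b := betaJ c' D j with hbdef
  set a := alpha D with hadef
  set β := beta7 D with hβdef
  set r : ℝ := δ / 4 with hr
  have hr0 : 0 < r := by positivity
  have hαδ : 20 * a ≤ δ := by linarith only [hδα]
  have hL0 : 0 < Real.log (P2 D) := lt_of_lt_of_le (by positivity) hLlow
  have hL : (Real.log (P2 D) : ℂ) ≠ 0 := by exact_mod_cast hL0.ne'
  have hx : 0 < P2 D / l₁ := by
    have : 0 < P2 D := by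
      rw [P2]; exact div_pos (Real.rpow_pos_of_pos (Real.exp_pos _) _) (pow_pos (Real.exp_pos _) _)
    have hl : (0 : ℝ) < l₁ := by exact_mod_cast hl₁
    positivity
  have hβ0 : β ≠ 0 := by intro h; rw [h, norm_zero] at hn7; linarith only [hn7, hα0]
  have hb0 : b ≠ 0 := by intro h; rw [h, norm_zero] at hb2; linarith only [hb2, hα0]
  have hβb : β ≠ b := by intro h; rw [h, sub_self, norm_zero] at hb7; linarith only [hb7, hα0]
  -- `ζ₁(1 + s − b) ≠ 0` on the disc `|s| < 3r`, which contains the box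
  have hzU : ∀ s ∈ ball (0 : ℂ) (3 * r), riemannZeta₁ (1 + s - b) ≠ 0 := by
    intro s hs
    have hs' : ‖s‖ < 3 * r := by simpa using hs
    have : ‖s - b‖ ≤ δ := by
      calc ‖s - b‖ ≤ ‖s‖ + ‖b‖ := norm_sub_le _ _
        _ ≤ 3 * r + 4 * a := by linarith only [hs', hb4]
        _ ≤ δ := by rw [hr]; linarith only [hαδ, hα0]
    have := (hζ (s - b) this).2.2
    rwa [show (1 : ℂ) + (s - b) = 1 + s - b by ring] at this
  set G : ℂ → ℂ := fun s =>
    riemannZeta₁ (1 + s) * (s - b) * (riemannZeta₁ (1 + s - b))⁻¹ *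
      ((P2 D / l₁ : ℝ) : ℂ) ^ s / (Real.log (P2 D) : ℂ) with hGdef
  have hGd : DifferentiableOn ℂ G (ball (0 : ℂ) (3 * r)) := differentiableOn_G c' D j l₁ hx hzU
  have hU : IsOpen (ball (0 : ℂ) (3 * r)) := isOpen_ball
  have hKU : Icc (-r) ε ×ℂ Icc (-r) r ⊆ ball (0 : ℂ) (3 * r) := box_subset_ball hr0 hεδ
  -- the G-form of the integrand off `0` and `b`
  have hGform : ∀ s ∈ ball (0 : ℂ) (3 * r), s ≠ 0 → s ≠ b →
      intB2 c' D j l₁ s = G s / (s * (s - β) ^ 2) := by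
    intro s hs hs0 hsb
    exact intB2_eq_G_div c' D j l₁ hs0 hsb (hzU s hs) hL
  -- the three special points lie in the open box
  have hn0 : ‖(0 : ℂ)‖ < r := by rw [norm_zero]; exact hr0
  have hnβ : ‖β‖ < r := by rw [hn7, hr]; linarith only [hαδ, hα0]
  have hnb : ‖b‖ < r := by rw [hr]; linarith only [hb4, hαδ, hα0]
  have hre0 : (0 : ℂ).re < ε := by simpa using hε
  have hβ7 : β = ((5 * a / 2 : ℝ) : ℂ) * I := by rw [hβdef, beta7, ← hadef]; push_cast; ring
  have hreβ : β.re < ε := by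
    rw [hβ7, Complex.re_ofReal_mul, Complex.I_re, mul_zero]; exact hε
  have hreb : b.re < ε := by
    obtain ⟨t, ht, -⟩ := Typed.AppendixB.betaJ_bound c' D j hα0.le (by linarith only [hℓ2])
    rw [hbdef, ht, Complex.re_ofReal_mul, Complex.I_re, mul_zero]; exact hε
  set S : Finset ℂ := {0, β, b} with hSdef
  have hSsub : ((S : Set ℂ)) ⊆ Ioo (-r) ε ×ℂ Ioo (-r) r := by
    intro p hp
    simp only [hSdef, Finset.coe_insert, Finset.coe_singleton, mem_insert_iff,
      mem_singleton_iff] at hp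
    rcases hp with rfl | rfl | rfl
    · exact mem_box_of_norm_lt hn0 hre0
    · exact mem_box_of_norm_lt hnβ hreβ
    · exact mem_box_of_norm_lt hnb hreb
  -- `intB2` is differentiable on the disc off `{0, β, b}`
  have hFd : DifferentiableOn ℂ (intB2 c' D j l₁) (ball (0 : ℂ) (3 * r) \ ↑S) := by
    intro s hs
    obtain ⟨hsU, hsS⟩ := hs
    simp only [hSdef, Finset.coe_insert, Finset.coe_singleton, mem_insert_iff,
      mem_singleton_iff, not_or] at hsS
    obtain ⟨hs0, hsβ, hsb⟩ := hsS
    -- near `s`, `intB2 = G/(z(z−β)²)`, which is differentiable at `s`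
    have hopen : IsOpen (ball (0 : ℂ) (3 * r) ∩ {z : ℂ | z ≠ 0 ∧ z ≠ b}) :=
      hU.inter (isOpen_ne.inter isOpen_ne)
    have hmem : s ∈ ball (0 : ℂ) (3 * r) ∩ {z : ℂ | z ≠ 0 ∧ z ≠ b} := ⟨hsU, hs0, hsb⟩
    have heq : intB2 c' D j l₁ =ᶠ[𝓝 s] fun z => G z / (z * (z - β) ^ 2) := by
      refine Filter.eventuallyEq_of_mem (hopen.mem_nhds hmem) fun z hz => ?_
      exact hGform z hz.1 hz.2.1 hz.2.2
    have hGs : DifferentiableAt ℂ G s := hGd.differentiableAt (hU.mem_nhds hsU)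
    have hden : DifferentiableAt ℂ (fun z : ℂ => z * (z - β) ^ 2) s :=
      differentiableAt_id.mul ((differentiableAt_id.sub_const β).pow 2)
    have hden0 : s * (s - β) ^ 2 ≠ 0 :=
      mul_ne_zero hs0 (pow_ne_zero _ (sub_ne_zero.mpr hsβ))
    exact ((hGs.div hden hden0).congr_of_eventuallyEq heq).differentiableWithinAt
  -- residue data
  set res : ℂ → ℂ := fun p =>
    if p = 0 then G 0 / β ^ 2 else if p = β then deriv G β / β - G β / β ^ 2 else 0 with hresdef
  have hpole : ∀ p ∈ S, ∃ φ : ℂ → ℂ, ∃ V ∈ 𝓝 p, DifferentiableOn ℂ φ V ∧ deriv φ p = res p ∧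
      ∀ z ∈ V, z ≠ p → intB2 c' D j l₁ z = φ z / (z - p) ^ 2 := by
    intro p hp
    simp only [hSdef, Finset.mem_insert, Finset.mem_singleton] at hp
    rcases hp with rfl | rfl | rfl
    · -- simple pole at `0`: `intB2 = ψ/(z − 0)` with `ψ = G/(z−β)²`
      have hV : ball (0 : ℂ) (3 * r) ∩ {z : ℂ | z ≠ b ∧ z ≠ β} ∈ 𝓝 (0 : ℂ) :=
        (hU.inter (isOpen_ne.inter isOpen_ne)).mem_nhds ⟨mem_ball_self (by positivity), hb0.symm, hβ0.symm⟩
      have hψ : DifferentiableOn ℂ (fun z => G z / (z - β) ^ 2)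
          (ball (0 : ℂ) (3 * r) ∩ {z : ℂ | z ≠ b ∧ z ≠ β}) := by
        intro z hz
        have hGz : DifferentiableAt ℂ G z := hGd.differentiableAt (hU.mem_nhds hz.1)
        exact (hGz.div ((differentiableAt_id.sub_const β).pow 2)
          (pow_ne_zero _ (sub_ne_zero.mpr hz.2.2))).differentiableWithinAt
      have hF0 : ∀ z ∈ ball (0 : ℂ) (3 * r) ∩ {z : ℂ | z ≠ b ∧ z ≠ β}, z ≠ 0 →
          intB2 c' D j l₁ z = G z / (z - β) ^ 2 / (z - 0) := by
        intro z hz hz0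
        rw [hGform z hz.1 hz0 hz.2.1, sub_zero]
        have h1 : z - β ≠ 0 := sub_ne_zero.mpr hz.2.2
        field_simp
      obtain ⟨φ, W, hW, hφd, hφ', hF⟩ := doublePole_data_of_simplePole hV hψ hF0
      refine ⟨φ, W, hW, hφd, ?_, hF⟩
      rw [hφ', hresdef]
      simp only [if_true, zero_sub, neg_sq]
    · -- double pole at `β`: `intB2 = φ/(z − β)²` with `φ = G/z`
      have hV : ball (0 : ℂ) (3 * r) ∩ {z : ℂ | z ≠ 0 ∧ z ≠ b} ∈ 𝓝 β :=
        (hU.inter (isOpen_ne.inter isOpen_ne)).mem_nhds ⟨by simpa using (show ‖β‖ < 3 * r by linarith only [hnβ, hr0]), hβ0, hβb⟩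
      refine ⟨fun z => G z / z, _, hV, ?_, ?_, ?_⟩
      · intro z hz
        have hGz : DifferentiableAt ℂ G z := hGd.differentiableAt (hU.mem_nhds hz.1)
        exact (hGz.div differentiableAt_id hz.2.1).differentiableWithinAt
      · have hGβ : DifferentiableAt ℂ G β :=
          hGd.differentiableAt (hU.mem_nhds (by simpa using (show ‖β‖ < 3 * r by linarith only [hnβ, hr0])))
        have hd : HasDerivAt (fun z => G z / z) ((deriv G β * β - G β * 1) / β ^ 2) β :=
          hGβ.hasDerivAt.div (hasDerivAt_id β) hβ0
        rw [hd.deriv, hresdef]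
        simp only [hβ0, if_false, if_true]
        rw [div_sub_div _ _ hβ0 (pow_ne_zero 2 hβ0), div_eq_div_iff (pow_ne_zero 2 hβ0)
          (mul_ne_zero hβ0 (pow_ne_zero 2 hβ0))]
        ring
      · intro z hz hzβ
        rw [hGform z hz.1 hz.2.1 hz.2.2]
        have h1 : z - β ≠ 0 := sub_ne_zero.mpr hzβ
        have h2 : z ≠ 0 := hz.2.1
        field_simp
    · -- removable point `b`: `intB2 = ψ/(z − b)` with `ψ = (z − b)·G/(z(z−β)²)`, `ψ(b) = 0`
      have hV : ball (0 : ℂ) (3 * r) ∩ {z : ℂ | z ≠ 0 ∧ z ≠ β} ∈ 𝓝 b :=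
        (hU.inter (isOpen_ne.inter isOpen_ne)).mem_nhds ⟨by simpa using (show ‖b‖ < 3 * r by linarith only [hnb, hr0]), hb0, hβb.symm⟩
      have hψ : DifferentiableOn ℂ (fun z => (z - b) * (G z / (z * (z - β) ^ 2)))
          (ball (0 : ℂ) (3 * r) ∩ {z : ℂ | z ≠ 0 ∧ z ≠ β}) := by
        intro z hz
        have hGz : DifferentiableAt ℂ G z := hGd.differentiableAt (hU.mem_nhds hz.1)
        have hden : DifferentiableAt ℂ (fun w : ℂ => w * (w - β) ^ 2) z :=
          differentiableAt_id.mul ((differentiableAt_id.sub_const β).pow 2)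
        exact ((differentiableAt_id.sub_const b).mul (hGz.div hden
          (mul_ne_zero hz.2.1 (pow_ne_zero _ (sub_ne_zero.mpr hz.2.2))))).differentiableWithinAt
      have hFb : ∀ z ∈ ball (0 : ℂ) (3 * r) ∩ {z : ℂ | z ≠ 0 ∧ z ≠ β}, z ≠ b →
          intB2 c' D j l₁ z = (z - b) * (G z / (z * (z - β) ^ 2)) / (z - b) := by
        intro z hz hzb
        rw [hGform z hz.1 hz.2.1 hzb]
        have h1 : z - b ≠ 0 := sub_ne_zero.mpr hzb
        field_simp
      obtain ⟨φ, W, hW, hφd, hφ', hF⟩ := doublePole_data_of_simplePole hV hψ hFb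
      refine ⟨φ, W, hW, hφd, ?_, hF⟩
      rw [hφ', hresdef]
      simp only [sub_self, zero_mul, hb0, if_false, hβb.symm]
  -- the residue theorem on the box
  have hrect := rectBoundaryIntegral_eq_sum_of_doublePoles (a := -r) (b := ε) (c := -r) (d := r)
    (by linarith only [hr0, hε]) (by linarith only [hr0]) S (intB2 c' D j l₁) res
    (ball (0 : ℂ) (3 * r)) hU hKU hSsub hFd hpole
  -- the sum of the residues
  have hS0β : (0 : ℂ) ∉ ({β, b} : Finset ℂ) := by
    simp only [Finset.mem_insert, Finset.mem_singleton, not_or]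
    exact ⟨hβ0.symm, hb0.symm⟩
  have hSβb : β ∉ ({b} : Finset ℂ) := by simpa using hβb
  have hres0 : res 0 = G 0 / β ^ 2 := by simp only [hresdef, if_true]
  have hresβ : res β = deriv G β / β - G β / β ^ 2 := by simp only [hresdef, hβ0, if_false, if_true]
  have hresb : res b = 0 := by simp only [hresdef, hb0, if_false, hβb.symm]
  have hsum : ∑ p ∈ S, res p = G 0 / β ^ 2 - G β / β ^ 2 + deriv G β / β := by
    rw [hSdef, Finset.sum_insert hS0β, Finset.sum_insert hSβb, Finset.sum_singleton, hres0, hresβ,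
      hresb]
    ring
  rw [hrect, hsum]
  -- and the circle has the same closed form
  have h2πI : (2 * π * I : ℂ) ≠ 0 := by
    apply mul_ne_zero (mul_ne_zero two_ne_zero _) Complex.I_ne_zero
    exact_mod_cast Real.pi_ne_zero
  have h5' : (∮ s in C((0 : ℂ), 5 * a), intB2 c' D j l₁ s) =
      2 * π * I * (G 0 / β ^ 2 - G β / β ^ 2 + deriv G β / β) := by
    rw [← h5, ← mul_assoc, mul_inv_cancel₀ h2πI, one_mul]
  rw [h5']

/-- **The rectangle around the poles carries the circle integral — boxes of any smaller size.**
The same identity for every box half-size `0 < δ′ ≤ δ₀` (the threshold in `D` then depends on `δ′`,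
which must dominate `5α`): for `D` large, `j ∈ {1,2,3}`, `l₁ ≥ 1`, `0 < ε ≤ δ′`,
`∮_{∂([−δ′, ε] × [−δ′, δ′])} intB2 = ∮_{|s|=5α} intB2`. This is the form the line-shift estimate uses
(it shrinks the box until `ζ₁` is controlled on it). [cite: Zhang2022LandauSiegel, App. B p.107] -/
theorem intB2_rect_eq_circle_of_le : ∃ δ₀ : ℝ, 0 < δ₀ ∧ ∀ δ' : ℝ, 0 < δ' → δ' ≤ δ₀ →
    ∃ D₀ : ℕ, ∀ D : ℕ, D₀ ≤ D →
    ∀ j ∈ ({1, 2, 3} : Finset ℕ), ∀ l₁ : ℕ, 1 ≤ l₁ → ∀ ε : ℝ, 0 < ε → ε ≤ δ' →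
      rectBoundaryIntegral (intB2 c' D j l₁) (-δ') ε (-δ') δ' =
        ∮ s in C((0 : ℂ), 5 * alpha D), intB2 c' D j l₁ s := by
  obtain ⟨δ, hδ, K, hK, hζ⟩ := zeta1_near_one
  obtain ⟨D₁, hcirc⟩ := circleIntegrals_intB2 c'
  refine ⟨δ / 4, by positivity, fun δ' hδ' hδ'δ => ?_⟩
  have hm : 0 < min (δ / 2) (2 * δ') := lt_min (by positivity) (by positivity)
  refine ⟨max D₁ (max 8 ⌈Real.exp (max (max 2 (60 * |c'| * π))
      (max (10 * π / min (δ / 2) (2 * δ')) (8 * K * π)))⌉₊),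
    fun D hD j hj l₁ hl₁ ε hε hεδ => ?_⟩
  obtain ⟨h5, -, -⟩ := hcirc D (le_trans (le_max_left _ _) hD) j hj l₁ hl₁
  obtain ⟨hℓ2, hc, hδα, -, hα0, -, hLlow⟩ := large_package c' hm hK
    (le_ell_of_ceil_exp_le₄ (le_trans (le_max_right _ _) (le_trans (le_max_right _ _) hD)))
  obtain ⟨-, hb4, hb2, hb7, hn7⟩ := betaJ_size c' hℓ2 hc hj
  -- notation (as in `AppendixBLemma151Circles`)
  set b := betaJ c' D j with hbdef
  set a := alpha D with hadef
  set β := beta7 D with hβdef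
  set r : ℝ := δ' with hr
  have hr0 : 0 < r := hδ'
  have hαδ : 20 * a ≤ δ := by linarith only [hδα, min_le_left (δ / 2) (2 * δ')]
  have hαr : 5 * a ≤ r := by linarith only [hδα, min_le_right (δ / 2) (2 * δ')]
  have hL0 : 0 < Real.log (P2 D) := lt_of_lt_of_le (by positivity) hLlow
  have hL : (Real.log (P2 D) : ℂ) ≠ 0 := by exact_mod_cast hL0.ne'
  have hx : 0 < P2 D / l₁ := by
    have : 0 < P2 D := by
      rw [P2]; exact div_pos (Real.rpow_pos_of_pos (Real.exp_pos _) _) (pow_pos (Real.exp_pos _) _)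
    have hl : (0 : ℝ) < l₁ := by exact_mod_cast hl₁
    positivity
  have hβ0 : β ≠ 0 := by intro h; rw [h, norm_zero] at hn7; linarith only [hn7, hα0]
  have hb0 : b ≠ 0 := by intro h; rw [h, norm_zero] at hb2; linarith only [hb2, hα0]
  have hβb : β ≠ b := by intro h; rw [h, sub_self, norm_zero] at hb7; linarith only [hb7, hα0]
  -- `ζ₁(1 + s − b) ≠ 0` on the disc `|s| < 3r`, which contains the box
  have hzU : ∀ s ∈ ball (0 : ℂ) (3 * r), riemannZeta₁ (1 + s - b) ≠ 0 := by
    intro s hs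
    have hs' : ‖s‖ < 3 * r := by simpa using hs
    have : ‖s - b‖ ≤ δ := by
      calc ‖s - b‖ ≤ ‖s‖ + ‖b‖ := norm_sub_le _ _
        _ ≤ 3 * r + 4 * a := by linarith only [hs', hb4]
        _ ≤ δ := by linarith only [hαδ, hα0, hδ'δ]
    have := (hζ (s - b) this).2.2
    rwa [show (1 : ℂ) + (s - b) = 1 + s - b by ring] at this
  set G : ℂ → ℂ := fun s =>
    riemannZeta₁ (1 + s) * (s - b) * (riemannZeta₁ (1 + s - b))⁻¹ *
      ((P2 D / l₁ : ℝ) : ℂ) ^ s / (Real.log (P2 D) : ℂ) with hGdef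
  have hGd : DifferentiableOn ℂ G (ball (0 : ℂ) (3 * r)) := differentiableOn_G c' D j l₁ hx hzU
  have hU : IsOpen (ball (0 : ℂ) (3 * r)) := isOpen_ball
  have hKU : Icc (-r) ε ×ℂ Icc (-r) r ⊆ ball (0 : ℂ) (3 * r) := box_subset_ball hr0 hεδ
  -- the G-form of the integrand off `0` and `b`
  have hGform : ∀ s ∈ ball (0 : ℂ) (3 * r), s ≠ 0 → s ≠ b →
      intB2 c' D j l₁ s = G s / (s * (s - β) ^ 2) := by
    intro s hs hs0 hsb
    exact intB2_eq_G_div c' D j l₁ hs0 hsb (hzU s hs) hL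
  -- the three special points lie in the open box
  have hn0 : ‖(0 : ℂ)‖ < r := by rw [norm_zero]; exact hr0
  have hnβ : ‖β‖ < r := by rw [hn7]; linarith only [hαr, hα0]
  have hnb : ‖b‖ < r := by linarith only [hb4, hαr, hα0]
  have hre0 : (0 : ℂ).re < ε := by simpa using hε
  have hβ7 : β = ((5 * a / 2 : ℝ) : ℂ) * I := by rw [hβdef, beta7, ← hadef]; push_cast; ring
  have hreβ : β.re < ε := by
    rw [hβ7, Complex.re_ofReal_mul, Complex.I_re, mul_zero]; exact hε
  have hreb : b.re < ε := by
    obtain ⟨t, ht, -⟩ := Typed.AppendixB.betaJ_bound c' D j hα0.le (by linarith only [hℓ2])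
    rw [hbdef, ht, Complex.re_ofReal_mul, Complex.I_re, mul_zero]; exact hε
  set S : Finset ℂ := {0, β, b} with hSdef
  have hSsub : ((S : Set ℂ)) ⊆ Ioo (-r) ε ×ℂ Ioo (-r) r := by
    intro p hp
    simp only [hSdef, Finset.coe_insert, Finset.coe_singleton, mem_insert_iff,
      mem_singleton_iff] at hp
    rcases hp with rfl | rfl | rfl
    · exact mem_box_of_norm_lt hn0 hre0
    · exact mem_box_of_norm_lt hnβ hreβ
    · exact mem_box_of_norm_lt hnb hreb
  -- `intB2` is differentiable on the disc off `{0, β, b}`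
  have hFd : DifferentiableOn ℂ (intB2 c' D j l₁) (ball (0 : ℂ) (3 * r) \ ↑S) := by
    intro s hs
    obtain ⟨hsU, hsS⟩ := hs
    simp only [hSdef, Finset.coe_insert, Finset.coe_singleton, mem_insert_iff,
      mem_singleton_iff, not_or] at hsS
    obtain ⟨hs0, hsβ, hsb⟩ := hsS
    -- near `s`, `intB2 = G/(z(z−β)²)`, which is differentiable at `s`
    have hopen : IsOpen (ball (0 : ℂ) (3 * r) ∩ {z : ℂ | z ≠ 0 ∧ z ≠ b}) :=
      hU.inter (isOpen_ne.inter isOpen_ne)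
    have hmem : s ∈ ball (0 : ℂ) (3 * r) ∩ {z : ℂ | z ≠ 0 ∧ z ≠ b} := ⟨hsU, hs0, hsb⟩
    have heq : intB2 c' D j l₁ =ᶠ[𝓝 s] fun z => G z / (z * (z - β) ^ 2) := by
      refine Filter.eventuallyEq_of_mem (hopen.mem_nhds hmem) fun z hz => ?_
      exact hGform z hz.1 hz.2.1 hz.2.2
    have hGs : DifferentiableAt ℂ G s := hGd.differentiableAt (hU.mem_nhds hsU)
    have hden : DifferentiableAt ℂ (fun z : ℂ => z * (z - β) ^ 2) s :=
      differentiableAt_id.mul ((differentiableAt_id.sub_const β).pow 2)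
    have hden0 : s * (s - β) ^ 2 ≠ 0 :=
      mul_ne_zero hs0 (pow_ne_zero _ (sub_ne_zero.mpr hsβ))
    exact ((hGs.div hden hden0).congr_of_eventuallyEq heq).differentiableWithinAt
  -- residue data
  set res : ℂ → ℂ := fun p =>
    if p = 0 then G 0 / β ^ 2 else if p = β then deriv G β / β - G β / β ^ 2 else 0 with hresdef
  have hpole : ∀ p ∈ S, ∃ φ : ℂ → ℂ, ∃ V ∈ 𝓝 p, DifferentiableOn ℂ φ V ∧ deriv φ p = res p ∧
      ∀ z ∈ V, z ≠ p → intB2 c' D j l₁ z = φ z / (z - p) ^ 2 := by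
    intro p hp
    simp only [hSdef, Finset.mem_insert, Finset.mem_singleton] at hp
    rcases hp with rfl | rfl | rfl
    · -- simple pole at `0`: `intB2 = ψ/(z − 0)` with `ψ = G/(z−β)²`
      have hV : ball (0 : ℂ) (3 * r) ∩ {z : ℂ | z ≠ b ∧ z ≠ β} ∈ 𝓝 (0 : ℂ) :=
        (hU.inter (isOpen_ne.inter isOpen_ne)).mem_nhds ⟨mem_ball_self (by positivity), hb0.symm, hβ0.symm⟩
      have hψ : DifferentiableOn ℂ (fun z => G z / (z - β) ^ 2)
          (ball (0 : ℂ) (3 * r) ∩ {z : ℂ | z ≠ b ∧ z ≠ β}) := by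
        intro z hz
        have hGz : DifferentiableAt ℂ G z := hGd.differentiableAt (hU.mem_nhds hz.1)
        exact (hGz.div ((differentiableAt_id.sub_const β).pow 2)
          (pow_ne_zero _ (sub_ne_zero.mpr hz.2.2))).differentiableWithinAt
      have hF0 : ∀ z ∈ ball (0 : ℂ) (3 * r) ∩ {z : ℂ | z ≠ b ∧ z ≠ β}, z ≠ 0 →
          intB2 c' D j l₁ z = G z / (z - β) ^ 2 / (z - 0) := by
        intro z hz hz0
        rw [hGform z hz.1 hz0 hz.2.1, sub_zero]
        have h1 : z - β ≠ 0 := sub_ne_zero.mpr hz.2.2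
        field_simp
      obtain ⟨φ, W, hW, hφd, hφ', hF⟩ := doublePole_data_of_simplePole hV hψ hF0
      refine ⟨φ, W, hW, hφd, ?_, hF⟩
      rw [hφ', hresdef]
      simp only [if_true, zero_sub, neg_sq]
    · -- double pole at `β`: `intB2 = φ/(z − β)²` with `φ = G/z`
      have hV : ball (0 : ℂ) (3 * r) ∩ {z : ℂ | z ≠ 0 ∧ z ≠ b} ∈ 𝓝 β :=
        (hU.inter (isOpen_ne.inter isOpen_ne)).mem_nhds ⟨by simpa using (show ‖β‖ < 3 * r by linarith only [hnβ, hr0]), hβ0, hβb⟩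
      refine ⟨fun z => G z / z, _, hV, ?_, ?_, ?_⟩
      · intro z hz
        have hGz : DifferentiableAt ℂ G z := hGd.differentiableAt (hU.mem_nhds hz.1)
        exact (hGz.div differentiableAt_id hz.2.1).differentiableWithinAt
      · have hGβ : DifferentiableAt ℂ G β :=
          hGd.differentiableAt (hU.mem_nhds (by simpa using (show ‖β‖ < 3 * r by linarith only [hnβ, hr0])))
        have hd : HasDerivAt (fun z => G z / z) ((deriv G β * β - G β * 1) / β ^ 2) β :=
          hGβ.hasDerivAt.div (hasDerivAt_id β) hβ0
        rw [hd.deriv, hresdef]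
        simp only [hβ0, if_false, if_true]
        rw [div_sub_div _ _ hβ0 (pow_ne_zero 2 hβ0), div_eq_div_iff (pow_ne_zero 2 hβ0)
          (mul_ne_zero hβ0 (pow_ne_zero 2 hβ0))]
        ring
      · intro z hz hzβ
        rw [hGform z hz.1 hz.2.1 hz.2.2]
        have h1 : z - β ≠ 0 := sub_ne_zero.mpr hzβ
        have h2 : z ≠ 0 := hz.2.1
        field_simp
    · -- removable point `b`: `intB2 = ψ/(z − b)` with `ψ = (z − b)·G/(z(z−β)²)`, `ψ(b) = 0`
      have hV : ball (0 : ℂ) (3 * r) ∩ {z : ℂ | z ≠ 0 ∧ z ≠ β} ∈ 𝓝 b :=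
        (hU.inter (isOpen_ne.inter isOpen_ne)).mem_nhds ⟨by simpa using (show ‖b‖ < 3 * r by linarith only [hnb, hr0]), hb0, hβb.symm⟩
      have hψ : DifferentiableOn ℂ (fun z => (z - b) * (G z / (z * (z - β) ^ 2)))
          (ball (0 : ℂ) (3 * r) ∩ {z : ℂ | z ≠ 0 ∧ z ≠ β}) := by
        intro z hz
        have hGz : DifferentiableAt ℂ G z := hGd.differentiableAt (hU.mem_nhds hz.1)
        have hden : DifferentiableAt ℂ (fun w : ℂ => w * (w - β) ^ 2) z :=
          differentiableAt_id.mul ((differentiableAt_id.sub_const β).pow 2)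
        exact ((differentiableAt_id.sub_const b).mul (hGz.div hden
          (mul_ne_zero hz.2.1 (pow_ne_zero _ (sub_ne_zero.mpr hz.2.2))))).differentiableWithinAt
      have hFb : ∀ z ∈ ball (0 : ℂ) (3 * r) ∩ {z : ℂ | z ≠ 0 ∧ z ≠ β}, z ≠ b →
          intB2 c' D j l₁ z = (z - b) * (G z / (z * (z - β) ^ 2)) / (z - b) := by
        intro z hz hzb
        rw [hGform z hz.1 hz.2.1 hzb]
        have h1 : z - b ≠ 0 := sub_ne_zero.mpr hzb
        field_simp
      obtain ⟨φ, W, hW, hφd, hφ', hF⟩ := doublePole_data_of_simplePole hV hψ hFb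
      refine ⟨φ, W, hW, hφd, ?_, hF⟩
      rw [hφ', hresdef]
      simp only [sub_self, zero_mul, hb0, if_false, hβb.symm]
  -- the residue theorem on the box
  have hrect := rectBoundaryIntegral_eq_sum_of_doublePoles (a := -r) (b := ε) (c := -r) (d := r)
    (by linarith only [hr0, hε]) (by linarith only [hr0]) S (intB2 c' D j l₁) res
    (ball (0 : ℂ) (3 * r)) hU hKU hSsub hFd hpole
  -- the sum of the residues
  have hS0β : (0 : ℂ) ∉ ({β, b} : Finset ℂ) := by
    simp only [Finset.mem_insert, Finset.mem_singleton, not_or]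
    exact ⟨hβ0.symm, hb0.symm⟩
  have hSβb : β ∉ ({b} : Finset ℂ) := by simpa using hβb
  have hres0 : res 0 = G 0 / β ^ 2 := by simp only [hresdef, if_true]
  have hresβ : res β = deriv G β / β - G β / β ^ 2 := by simp only [hresdef, hβ0, if_false, if_true]
  have hresb : res b = 0 := by simp only [hresdef, hb0, if_false, hβb.symm]
  have hsum : ∑ p ∈ S, res p = G 0 / β ^ 2 - G β / β ^ 2 + deriv G β / β := by
    rw [hSdef, Finset.sum_insert hS0β, Finset.sum_insert hSβb, Finset.sum_singleton, hres0, hresβ,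
      hresb]
    ring
  rw [hrect, hsum]
  -- and the circle has the same closed form
  have h2πI : (2 * π * I : ℂ) ≠ 0 := by
    apply mul_ne_zero (mul_ne_zero two_ne_zero _) Complex.I_ne_zero
    exact_mod_cast Real.pi_ne_zero
  have h5' : (∮ s in C((0 : ℂ), 5 * a), intB2 c' D j l₁ s) =
      2 * π * I * (G 0 / β ^ 2 - G β / β ^ 2 + deriv G β / β) := by
    rw [← h5, ← mul_assoc, mul_inv_cancel₀ h2πI, one_mul]
  rw [h5']

end Rect

end Literature.NumberTheory.LFunctions.Zhang2022.Skeleton
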